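import Summits.QuantumFields.YangMills.Theorems.BalabanUVNodesN19JointLawSharpRate

/-!
# YM-DAG node N19 (= NE7 proper) — THE CONVERSE PRICE: the LAW currency buys N19's `Target` LINEARLY (and the target buys it back only at `1∕log`)

Cell `pub-ymgap`, HUMAN RULING D-0062 (Track A) ∕ D-0149 (work-bound push), R141 (C) wider-strategy seat `pub-ymgap-dag-n19-e` (strategy s3 =
ALTERNATIVE CURRENCY), generation g21, module 1 (lineage module 64).  Route `Summits/QuantumFields/YangMills/Theses/BalabanUVNodes.lean` rev 25,
cluster item K3⁷ «SpineGivenEndpointR13SepCoPH» (stmt-QuantumFields-20544); filed `--supports` that item `--as helper` (it proves no registered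
stub).  COUNT-NEUTRAL: [folklore] real analysis ∕ probability over Mathlib + the lineage BY NAME — module 62 `…N19JointLawSharpRate`
(`abs_integral_sub_continuumLaw_le_inv_log_of_uniformTarget`), p505344 `…N19ContinuumLawAtScheme` (`exists_continuumLaw_of_target`), p550501
`…N19LawPriceSymmetric` (`ae_abs_le_one_of_Icc_symm`), the tree's `T4GenFunBounds` (`genFun_schemeZ_eq_cgf`, `expectAt_eq_integral_gibbs`,
`exp_neg_le_mgf_of_abs_le`, `exp_mul_le_of_abs_le`); `Spine.NE7.Target` (N19's DECL-target SHAPE, NOT PRINTED, NOT proved) is CONCLUDED from a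
law-level HYPOTHESIS; no Theses import; NOT a discharge claim.

THE QUESTION.  Every law-level theorem of this lineage runs WINDOW ⇒ LAW: cgfs `ε`-close on `|t| ≤ l₀` make the laws of `[−1,1]`-valued
observables `Θ(log(e+L)∕(1+L))`-close on bounded-Lipschitz test functions (`L = log ε⁻¹`; p553677 ∕ p555512, two-sided), uniform moment closeness
`r` makes them `Θ(1∕(1 + log r⁻¹))`-close (module 63, two-sided), and at the scheme N19's `Target` makes the laws of `∏os` converge at
`48(K+G)∕(1 + log R_K⁻¹)` (module 62).  What does the CONVERSE cost — if one controlled the LAWS of the string observables directly (the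
«law currency»: bounded-Lipschitz increments `|∫g dlaw_{K+1} − ∫g dlaw_K| ≤ (K_g + G_g)·D_K`), what does that buy of N19's DECL target
`Spine.NE7.Target vol l₀ δ (schemeZ S os) = MatchingModConstants ∧ Summable δ`?

THE ANSWER: EVERYTHING, LINEARLY.  §1 (laws on `[−1,1]`): `x ↦ e^{tx}` is `l₀e^{l₀}`-Lipschitz and `e^{l₀}`-bounded on `[−1,1]` for `|t| ≤ l₀`
(mean value inequality), so ★ `abs_mgf_sub_mgf_le_of_lawClose`: `|Δmgf(t)| ≤ (l₀+1)e^{l₀}·D`; both mgfs are `≥ e^{−l₀}` there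
(`exp_neg_le_mgf_id_of_Icc_symm`), and `log` is
`e^{l₀}`-Lipschitz on `[e^{−l₀}, ∞)` (`abs_log_sub_log_le_of_exp_neg_le`), so ★ `abs_cgf_sub_cgf_le_of_lawClose`: `|Δcgf(t)| ≤ (l₀+1)e^{2l₀}·D`.
§2 (the scheme): the generating function of node U6 IS the cgf of `∏os` under `gibbs_K` (`genFun_schemeZ_eq_cgf`) = the cgf of `id` under the LAW
`gibbs_K.map (∏os)` (`mgf_id_map`), so summable law increments give uniformly summable increments of the generating functions, whence — with the
CANONICAL constants `c_K = log Z_{K+1}(0) − log Z_K(0)` (the device of p462782 `matchingModConstants_of_genFun_increments`) —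
  ★★ `target_of_summable_lawIncrements`: `Spine.NE7.Target vol l₀ (K ↦ (l₀+1)e^{2l₀}D_K∕vol) (schemeZ S os)` (any `vol > 0`, `l₀ ≥ 0`);
  ★ `target_of_summable_lawRates`: the same from summable RATES `R_K` to any limit law (`D_K = R_K + R_{K+1}`);
  ★ `hasContinuumLimit_of_summable_lawIncrements`: summable law increments for every string ⇒ `HasContinuumLimit S` directly (`g = id`).
§3 THE ROUND TRIP ★★ `law_rate_of_summable_lawIncrements`: COMMON summable law increments `D` for every string (`0 < l₀`) ⇒ uniform `Target` with
`vol·δ_K = (l₀+1)e^{2l₀}D_K` ⇒ (module 62 BY NAME, the continuum law `ν_os` of p505344) `|∫g(∏os) dgibbs_K − ∫g dν_os| ≤ 48(K_g+G_g)∕(1 + log R_K⁻¹)`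
with `R_K = (4e^{1+l₀}∕l₀)·τ_K·(1 + log⁺τ_K⁻¹)`, `τ_K = Σ_j 2(l₀+1)e^{2l₀}D_{K+j}` — summable `D` in, `1∕log(1∕tail D)` out.
SO: the law currency and the window currency are EQUIVALENT MODULO THE INTRINSIC LOGARITHM — LAW ⇒ WINDOW linear (this file), WINDOW ⇒ LAW
`Θ(1∕log)` and not better (p555512 ∕ module 63 lower bounds).  HONEST ASYMMETRY: `Target` does NOT give summable law increments in general (for the
programme's geometric remainders the law increments it yields are `≍ 1∕K`); the window (N19's `Target`) is the CHEAPER of the two currencies, the law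
currency a strictly more demanding road to the same node.

HONEST FRAMING (binding).  Elementary and [folklore]; the law-increment hypothesis is a HYPOTHESIS (inhabited trivially by any level-constant scheme;
nothing of Bałaban's instantiated); NO consumer in the DAG today (a statement comparing the seat's own currencies); NE7 NOT PRINTED, NOT proved; N19
NOT discharged; count-neutral.  One finite `T⁴` programme at fixed `ε`; nothing continuum ∕ `ℝ⁴` ∕ OS ∕ mass-gap ∕ Clay.  0 `def` ∕ 0 `sorry`.
-/

noncomputable section

open Real Filter Topology MeasureTheory ProbabilityTheory

namespace Summit.QuantumFields.YangMills.Theorems.BalabanUVNodesN19LawIncrementsTarget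

open Literature.MathematicalPhysics.QuantumFieldTheory.Balaban1983to89
open T4GenFunBounds (prodObs gibbsMeasure schemeZ genFun_schemeZ_eq_cgf expectAt_eq_integral_gibbs)
open T4CauchySum (MatchingModConstants genFun)
open Missing (TorusScheme HasContinuumLimit)
open Summit.QuantumFields.BalabanUV.T4Continuum.Spine
open Summit.QuantumFields.YangMills.Theorems.BalabanUVNodesN19LawPriceSymmetric (ae_abs_le_one_of_Icc_symm)
open Summit.QuantumFields.YangMills.BalabanUVNodes.N19ContinuumLawAtScheme (exists_continuumLaw_of_target)
open Summit.QuantumFields.YangMills.Theorems.BalabanUVNodesN19JointLawSharpRate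
  (abs_integral_sub_continuumLaw_le_inv_log_of_uniformTarget)

/-! ## §1 Laws on `[−1,1]`: bounded-Lipschitz closeness `D` ⇒ `|Δmgf| ≤ (l₀+1)e^{l₀}D`, `|Δcgf| ≤ (l₀+1)e^{2l₀}D` on the window [folklore] -/

/-- `log` is `e^{l}`-Lipschitz on `[e^{−l}, ∞)`: `e^{−l} ≤ a, b` ⇒ `|log a − log b| ≤ e^{l}·|a − b|` (`log(a∕b) ≤ a∕b − 1`). [folklore] -/
theorem abs_log_sub_log_le_of_exp_neg_le {l a b : ℝ} (ha : Real.exp (-l) ≤ a) (hb : Real.exp (-l) ≤ b) :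
    |Real.log a - Real.log b| ≤ Real.exp l * |a - b| := by
  have hl : 0 < Real.exp (-l) := Real.exp_pos _
  have ha0 : 0 < a := hl.trans_le ha
  have hb0 : 0 < b := hl.trans_le hb
  have hinv : ∀ {c : ℝ}, Real.exp (-l) ≤ c → c⁻¹ ≤ Real.exp l := fun {c} hc =>
    calc c⁻¹ ≤ (Real.exp (-l))⁻¹ := inv_anti₀ hl hc
      _ = Real.exp l := by rw [Real.exp_neg, inv_inv]
  -- one direction: `log a − log b ≤ (a − b)∕b ≤ |a − b|·e^l`
  have key : ∀ {a b : ℝ}, 0 < a → 0 < b → Real.exp (-l) ≤ b → Real.log a - Real.log b ≤ Real.exp l * |a - b| :=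
    fun {a b} ha0 hb0 hb => by
    have h1 : Real.log a - Real.log b ≤ a / b - 1 := by
      rw [← Real.log_div ha0.ne' hb0.ne']
      exact Real.log_le_sub_one_of_pos (div_pos ha0 hb0)
    have h2 : a / b - 1 = (a - b) * b⁻¹ := by field_simp
    calc Real.log a - Real.log b ≤ (a - b) * b⁻¹ := h2 ▸ h1
      _ ≤ |a - b| * b⁻¹ := mul_le_mul_of_nonneg_right (le_abs_self _) (inv_nonneg.2 hb0.le)
      _ ≤ |a - b| * Real.exp l := mul_le_mul_of_nonneg_left (hinv hb) (abs_nonneg _)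
      _ = Real.exp l * |a - b| := mul_comm _ _
  rw [abs_sub_le_iff]
  refine ⟨key ha0 hb0 hb, ?_⟩
  rw [abs_sub_comm]
  exact key hb0 ha0 ha

/-- `x ↦ e^{tx}` is `l₀e^{l₀}`-Lipschitz on `[−1,1]` for `|t| ≤ l₀` (mean value inequality). [folklore] -/
theorem abs_exp_mul_sub_exp_mul_le {l₀ t : ℝ} (ht : |t| ≤ l₀) {x y : ℝ} (hx : x ∈ Set.Icc (-1 : ℝ) 1) (hy : y ∈ Set.Icc (-1 : ℝ) 1) :
    |Real.exp (t * x) - Real.exp (t * y)| ≤ l₀ * Real.exp l₀ * |x - y| := by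
  have hderiv : ∀ z : ℝ, HasDerivAt (fun z => Real.exp (t * z)) (Real.exp (t * z) * t) z := fun z => by
    simpa using ((hasDerivAt_id z).const_mul t).exp
  have hdiff : ∀ z ∈ Set.Icc (-1 : ℝ) 1, DifferentiableAt ℝ (fun z => Real.exp (t * z)) z :=
    fun z _ => (hderiv z).differentiableAt
  have hbound : ∀ z ∈ Set.Icc (-1 : ℝ) 1, ‖deriv (fun z => Real.exp (t * z)) z‖ ≤ l₀ * Real.exp l₀ := by
    intro z hz
    rw [(hderiv z).deriv, Real.norm_eq_abs, abs_mul, abs_of_pos (Real.exp_pos _), mul_comm]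
    have hz1 : |z| ≤ 1 := abs_le.2 ⟨hz.1, hz.2⟩
    have h1 : Real.exp (t * z) ≤ Real.exp l₀ := by
      refine Real.exp_le_exp.2 ?_
      calc t * z ≤ |t * z| := le_abs_self _
        _ = |t| * |z| := abs_mul _ _
        _ ≤ l₀ * 1 := mul_le_mul ht hz1 (abs_nonneg _) ((abs_nonneg _).trans ht)
        _ = l₀ := mul_one _
    exact mul_le_mul ht h1 (Real.exp_pos _).le ((abs_nonneg _).trans ht)
  have h := (convex_Icc (-1 : ℝ) 1).norm_image_sub_le_of_norm_deriv_le hdiff hbound hy hx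
  simpa only [Real.norm_eq_abs] using h

variable {μ ν : Measure ℝ} [IsProbabilityMeasure μ] [IsProbabilityMeasure ν]

omit [IsProbabilityMeasure μ] [IsProbabilityMeasure ν] in
/-- ★ **LAW-CLOSE ⇒ MGF-CLOSE ON THE WINDOW.**  Two probability laws on `[−1,1]` that integrate every continuous `g`, `K`-Lipschitz and `G`-bounded
on `[−1,1]`, within `(K + G)·D`, have `|mgf ν t − mgf μ t| ≤ (l₀ + 1)e^{l₀}·D` for `|t| ≤ l₀` (`g = e^{t·}`: `K = l₀e^{l₀}`, `G = e^{l₀}`). [folklore] -/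
theorem abs_mgf_sub_mgf_le_of_lawClose (_hμ : μ (Set.Icc (-1 : ℝ) 1)ᶜ = 0) (_hν : ν (Set.Icc (-1 : ℝ) 1)ᶜ = 0)
    {D : ℝ} (hD : ∀ g : ℝ → ℝ, Continuous g → ∀ K G : ℝ, 0 ≤ K →
      (∀ x y : ℝ, x ∈ Set.Icc (-1 : ℝ) 1 → y ∈ Set.Icc (-1 : ℝ) 1 → |g x - g y| ≤ K * |x - y|) →
      (∀ x : ℝ, x ∈ Set.Icc (-1 : ℝ) 1 → |g x| ≤ G) → |∫ x, g x ∂ν - ∫ x, g x ∂μ| ≤ (K + G) * D)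
    {l₀ t : ℝ} (ht : |t| ≤ l₀) :
    |mgf id ν t - mgf id μ t| ≤ (l₀ + 1) * Real.exp l₀ * D := by
  have hl₀ : 0 ≤ l₀ := (abs_nonneg _).trans ht
  have hG : ∀ x : ℝ, x ∈ Set.Icc (-1 : ℝ) 1 → |Real.exp (t * x)| ≤ Real.exp l₀ := fun x hx => by
    rw [abs_of_pos (Real.exp_pos _)]
    have hx1 : |x| ≤ 1 := abs_le.2 ⟨hx.1, hx.2⟩
    refine (T4GenFunBounds.exp_mul_le_of_abs_le (B := 1) hx1).trans ?_
    rw [mul_one]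
    exact Real.exp_le_exp.2 ht
  have h := hD (fun x => Real.exp (t * x)) (Real.continuous_exp.comp (continuous_const.mul continuous_id))
    (l₀ * Real.exp l₀) (Real.exp l₀) (by positivity) (fun x y hx hy => abs_exp_mul_sub_exp_mul_le ht hx hy) hG
  have e : (l₀ * Real.exp l₀ + Real.exp l₀) * D = (l₀ + 1) * Real.exp l₀ * D := by ring
  simpa only [mgf, id, e] using h

/-- A probability law on `[−1,1]` has `mgf ≥ e^{−l₀}` on the window `|t| ≤ l₀`. [folklore] -/
theorem exp_neg_le_mgf_id_of_Icc_symm (κ : Measure ℝ) [IsProbabilityMeasure κ] (hκ : κ (Set.Icc (-1 : ℝ) 1)ᶜ = 0) {l₀ t : ℝ}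
    (ht : |t| ≤ l₀) : Real.exp (-l₀) ≤ mgf id κ t := by
  have h := T4GenFunBounds.exp_neg_le_mgf_of_abs_le (μ := κ) (X := id) aemeasurable_id (ae_abs_le_one_of_Icc_symm hκ) t
  rw [probReal_univ, one_mul, mul_one] at h
  exact (Real.exp_le_exp.2 (neg_le_neg ht)).trans h

/-- ★ **LAW-CLOSE ⇒ CGF-CLOSE ON THE WINDOW**: under the same hypotheses `|cgf ν t − cgf μ t| ≤ (l₀ + 1)e^{2l₀}·D` for `|t| ≤ l₀` (both mgfs are
`≥ e^{−l₀}` on the window, where `log` is `e^{l₀}`-Lipschitz).  LINEAR in `D` — against the `Θ(log(e+L)∕(1+L))` price of the opposite direction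
(p553677 ∕ p555512). [folklore] -/
theorem abs_cgf_sub_cgf_le_of_lawClose (hμ : μ (Set.Icc (-1 : ℝ) 1)ᶜ = 0) (hν : ν (Set.Icc (-1 : ℝ) 1)ᶜ = 0)
    {D : ℝ} (hD : ∀ g : ℝ → ℝ, Continuous g → ∀ K G : ℝ, 0 ≤ K →
      (∀ x y : ℝ, x ∈ Set.Icc (-1 : ℝ) 1 → y ∈ Set.Icc (-1 : ℝ) 1 → |g x - g y| ≤ K * |x - y|) →
      (∀ x : ℝ, x ∈ Set.Icc (-1 : ℝ) 1 → |g x| ≤ G) → |∫ x, g x ∂ν - ∫ x, g x ∂μ| ≤ (K + G) * D)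
    {l₀ t : ℝ} (ht : |t| ≤ l₀) :
    |cgf id ν t - cgf id μ t| ≤ (l₀ + 1) * Real.exp (2 * l₀) * D := by
  calc |cgf id ν t - cgf id μ t| = |Real.log (mgf id ν t) - Real.log (mgf id μ t)| := by rw [cgf, cgf]
    _ ≤ Real.exp l₀ * |mgf id ν t - mgf id μ t| :=
        abs_log_sub_log_le_of_exp_neg_le (exp_neg_le_mgf_id_of_Icc_symm ν hν ht) (exp_neg_le_mgf_id_of_Icc_symm μ hμ ht)
    _ ≤ Real.exp l₀ * ((l₀ + 1) * Real.exp l₀ * D) :=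
        mul_le_mul_of_nonneg_left (abs_mgf_sub_mgf_le_of_lawClose hμ hν hD ht) (Real.exp_pos _).le
    _ = (l₀ + 1) * Real.exp (2 * l₀) * D := by rw [show (2 : ℝ) * l₀ = l₀ + l₀ by ring, Real.exp_add]; ring

/-! ## §2 At the torus scheme: summable law increments of `∏os` ⇒ N19's DECL-target shape `Spine.NE7.Target` [bookkeeping] -/

section Scheme

variable {G : Type*} [GaugeGroup G] [MeasurableSpace G] [RegularGaugeGroup G] [HaarData G] {O : Type*}
  (S : TorusScheme G O) (hβ : ∀ K, 0 ≤ S.β K) (hm : ∀ K o, Measurable (S.obs K o)) (h1 : ∀ K o U, |S.obs K o U| ≤ 1)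
include hβ hm h1

omit [RegularGaugeGroup G] hβ in
/-- The law of `∏os` under `gibbs_K` is carried by `[−1,1]`. [bookkeeping] -/
theorem law_prodObs_Icc_compl (K : ℕ) (os : List O) :
    ((gibbsMeasure (S.P K) (S.β K)).map (prodObs S K os)) (Set.Icc (-1 : ℝ) 1)ᶜ = 0 := by
  rw [Measure.map_apply (T4GenFunBounds.measurable_prodObs S hm K os) measurableSet_Icc.compl]
  have he : prodObs S K os ⁻¹' (Set.Icc (-1 : ℝ) 1)ᶜ = ∅ := by
    ext U
    simp only [Set.mem_preimage, Set.mem_compl_iff, Set.mem_Icc, Set.mem_empty_iff_false, iff_false, not_not]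
    exact abs_le.1 (T4GenFunBounds.abs_prodObs_le_one S h1 K os U)
  rw [he, measure_empty]

/-- The cgf of `∏os` under `gibbs_K` is the cgf of `id` under its law; node U6's generating function is that cgf. [bookkeeping] -/
theorem genFun_schemeZ_eq_cgf_law (K : ℕ) (os : List O) (t : ℝ) :
    genFun (schemeZ S os) K t = cgf id ((gibbsMeasure (S.P K) (S.β K)).map (prodObs S K os)) t := by
  rw [genFun_schemeZ_eq_cgf S hβ hm h1, cgf, cgf, mgf_id_map (T4GenFunBounds.measurable_prodObs S hm K os).aemeasurable]

/-- ★★ **SUMMABLE LAW INCREMENTS ⇒ N19's DECL TARGET (LINEARLY).**  If for one string `os` the laws of `∏os` under consecutive Gibbs measures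
integrate every continuous `g`, `K_g`-Lipschitz and `G_g`-bounded on `[−1,1]`, within `(K_g + G_g)·D_K` with `Σ_K D_K < ∞`, then for every
`vol > 0` and every `l₀`: `Spine.NE7.Target vol l₀ (K ↦ (l₀+1)e^{2l₀}D_K∕vol) (schemeZ S os)` — matching modulo the CANONICAL constants
`log Z_{K+1}(0) − log Z_K(0)` with the summable remainder `(l₀+1)e^{2l₀}D_K`.  A HYPOTHESIS on the laws; nothing of Bałaban's instantiated. [bookkeeping] -/
theorem target_of_summable_lawIncrements {vol l₀ : ℝ} (hvol : 0 < vol) (os : List O) {D : ℕ → ℝ} (hDs : Summable D)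
    (hD : ∀ (K : ℕ) (g : ℝ → ℝ), Continuous g → ∀ Kg Gg : ℝ, 0 ≤ Kg →
      (∀ x y : ℝ, x ∈ Set.Icc (-1 : ℝ) 1 → y ∈ Set.Icc (-1 : ℝ) 1 → |g x - g y| ≤ Kg * |x - y|) →
      (∀ x : ℝ, x ∈ Set.Icc (-1 : ℝ) 1 → |g x| ≤ Gg) →
      |∫ U, g (prodObs S (K + 1) os U) ∂gibbsMeasure (S.P (K + 1)) (S.β (K + 1)) -
        ∫ U, g (prodObs S K os U) ∂gibbsMeasure (S.P K) (S.β K)| ≤ (Kg + Gg) * D K) :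
    NE7.Target vol l₀ (fun K => (l₀ + 1) * Real.exp (2 * l₀) * D K / vol) (schemeZ S os) := by
  haveI hP : ∀ K, IsProbabilityMeasure (gibbsMeasure (G := G) (S.P K) (S.β K)) := fun K =>
    T4GenFunBounds.isProbabilityMeasure_gibbsMeasure (G := G) (S.P K) (hβ K)
  have hmeas : ∀ K, AEMeasurable (prodObs S K os) (gibbsMeasure (S.P K) (S.β K)) := fun K =>
    (T4GenFunBounds.measurable_prodObs S hm K os).aemeasurable
  haveI : ∀ K, IsProbabilityMeasure ((gibbsMeasure (S.P K) (S.β K)).map (prodObs S K os)) := fun K =>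
    Measure.isProbabilityMeasure_map (hmeas K)
  -- the law-level hypothesis, read on the laws
  have hD' : ∀ (K : ℕ) (g : ℝ → ℝ), Continuous g → ∀ Kg Gg : ℝ, 0 ≤ Kg →
      (∀ x y : ℝ, x ∈ Set.Icc (-1 : ℝ) 1 → y ∈ Set.Icc (-1 : ℝ) 1 → |g x - g y| ≤ Kg * |x - y|) →
      (∀ x : ℝ, x ∈ Set.Icc (-1 : ℝ) 1 → |g x| ≤ Gg) →
      |∫ x, g x ∂(gibbsMeasure (S.P (K + 1)) (S.β (K + 1))).map (prodObs S (K + 1) os) -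
        ∫ x, g x ∂(gibbsMeasure (S.P K) (S.β K)).map (prodObs S K os)| ≤ (Kg + Gg) * D K := by
    intro K g hg Kg Gg hKg hK hG
    rw [integral_map (hmeas (K + 1)) hg.aestronglyMeasurable, integral_map (hmeas K) hg.aestronglyMeasurable]
    exact hD K g hg Kg Gg hKg hK hG
  refine ⟨fun K => ⟨Real.log (schemeZ S os (K + 1) 0) - Real.log (schemeZ S os K 0), fun t ht => ?_⟩,
    (hDs.mul_left _).div_const _⟩
  have e : Real.log (schemeZ S os (K + 1) t) - Real.log (schemeZ S os K t) -
      (Real.log (schemeZ S os (K + 1) 0) - Real.log (schemeZ S os K 0)) = genFun (schemeZ S os) (K + 1) t - genFun (schemeZ S os) K t := by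
    simp only [genFun]; ring
  rw [e, genFun_schemeZ_eq_cgf_law S hβ hm h1, genFun_schemeZ_eq_cgf_law S hβ hm h1, mul_div_cancel₀ _ hvol.ne']
  exact abs_cgf_sub_cgf_le_of_lawClose (law_prodObs_Icc_compl S hm h1 K os) (law_prodObs_Icc_compl S hm h1 (K + 1) os) (hD' K) ht

/-- ★ **SUMMABLE LAW RATES ⇒ N19's DECL TARGET.**  The same from summable RATES `R_K` of the laws of `∏os` to ANY reference law `ν` on the
bounded-Lipschitz class: increments `≤ (K_g+G_g)(R_K + R_{K+1})`, so `Spine.NE7.Target vol l₀ (K ↦ (l₀+1)e^{2l₀}(R_K + R_{K+1})∕vol) (schemeZ S os)`.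
[bookkeeping] -/
theorem target_of_summable_lawRates {vol l₀ : ℝ} (hvol : 0 < vol) (os : List O) (ν : Measure ℝ) {R : ℕ → ℝ}
    (hRs : Summable R)
    (hR : ∀ (K : ℕ) (g : ℝ → ℝ), Continuous g → ∀ Kg Gg : ℝ, 0 ≤ Kg →
      (∀ x y : ℝ, x ∈ Set.Icc (-1 : ℝ) 1 → y ∈ Set.Icc (-1 : ℝ) 1 → |g x - g y| ≤ Kg * |x - y|) →
      (∀ x : ℝ, x ∈ Set.Icc (-1 : ℝ) 1 → |g x| ≤ Gg) →
      |∫ U, g (prodObs S K os U) ∂gibbsMeasure (S.P K) (S.β K) - ∫ x, g x ∂ν| ≤ (Kg + Gg) * R K) :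
    NE7.Target vol l₀ (fun K => (l₀ + 1) * Real.exp (2 * l₀) * (R K + R (K + 1)) / vol) (schemeZ S os) := by
  refine target_of_summable_lawIncrements S hβ hm h1 hvol os (D := fun K => R K + R (K + 1))
    (hRs.add ((summable_nat_add_iff 1).2 hRs)) fun K g hg Kg Gg hKg hK hG => ?_
  have hK1 := hR (K + 1) g hg Kg Gg hKg hK hG
  have hK0 := hR K g hg Kg Gg hKg hK hG
  rw [abs_sub_comm] at hK0
  calc |∫ U, g (prodObs S (K + 1) os U) ∂gibbsMeasure (S.P (K + 1)) (S.β (K + 1)) -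
        ∫ U, g (prodObs S K os U) ∂gibbsMeasure (S.P K) (S.β K)|
      ≤ |∫ U, g (prodObs S (K + 1) os U) ∂gibbsMeasure (S.P (K + 1)) (S.β (K + 1)) - ∫ x, g x ∂ν| +
        |∫ x, g x ∂ν - ∫ U, g (prodObs S K os U) ∂gibbsMeasure (S.P K) (S.β K)| := abs_sub_le _ _ _
    _ ≤ (Kg + Gg) * R (K + 1) + (Kg + Gg) * R K := add_le_add hK1 hK0
    _ = (Kg + Gg) * (R K + R (K + 1)) := by ring

omit hm h1 in
/-- ★ **SUMMABLE LAW INCREMENTS FOR EVERY STRING ⇒ `HasContinuumLimit S`** directly (`g = id`: the joint expectations `S.expectAt K os` have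
summable increments `2D^{os}_K`, hence converge) — no window, no `Target` needed for node U0's first conjunct. [bookkeeping] -/
theorem hasContinuumLimit_of_summable_lawIncrements
    (hD : ∀ os : List O, ∃ D : ℕ → ℝ, Summable D ∧ ∀ (K : ℕ) (g : ℝ → ℝ), Continuous g → ∀ Kg Gg : ℝ, 0 ≤ Kg →
      (∀ x y : ℝ, x ∈ Set.Icc (-1 : ℝ) 1 → y ∈ Set.Icc (-1 : ℝ) 1 → |g x - g y| ≤ Kg * |x - y|) →
      (∀ x : ℝ, x ∈ Set.Icc (-1 : ℝ) 1 → |g x| ≤ Gg) →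
      |∫ U, g (prodObs S (K + 1) os U) ∂gibbsMeasure (S.P (K + 1)) (S.β (K + 1)) -
        ∫ U, g (prodObs S K os U) ∂gibbsMeasure (S.P K) (S.β K)| ≤ (Kg + Gg) * D K) :
    HasContinuumLimit S := by
  intro os
  obtain ⟨D, hDs, hD⟩ := hD os
  have hstep : ∀ K, dist (S.expectAt K os) (S.expectAt (K + 1) os) ≤ 2 * D K := fun K => by
    rw [dist_comm, Real.dist_eq, expectAt_eq_integral_gibbs S hβ, expectAt_eq_integral_gibbs S hβ]
    have h := hD K id continuous_id 1 1 zero_le_one (fun x y _ _ => by rw [one_mul]; rfl)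
      (fun x hx => abs_le.2 ⟨hx.1, hx.2⟩)
    simp only [id_eq, one_add_one_eq_two] at h
    exact h
  exact cauchySeq_tendsto_of_complete (cauchySeq_of_dist_le_of_summable _ hstep (hDs.mul_left 2))

/-! ## §3 THE ROUND TRIP: summable law increments in, `48(K+G)∕(1 + log R_K⁻¹)` out [bookkeeping] -/

/-- ★★ **THE ROUND TRIP (BY NAME).**  COMMON summable law increments `D` for EVERY string (`0 < l₀`, any `vol > 0`): then (§2) `Target` holds uniformly
with `vol·δ_K = (l₀+1)e^{2l₀}D_K`, so for every string there is a continuum law `ν` on `[−1,1]` receiving all continuous observables of `∏os`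
(p505344 `exists_continuumLaw_of_target`), and module 62's `abs_integral_sub_continuumLaw_le_inv_log_of_uniformTarget` prices the return journey: with
`τ_K = Σ_j 2(l₀+1)e^{2l₀}D_{K+j}` and `R_K = (4e^{1+l₀}∕l₀)·τ_K·(1 + log⁺τ_K⁻¹) ∈ (0,1]`,
`|∫g(∏os) dgibbs_K − ∫g dν| ≤ 48(K_g+G_g)∕(1 + log R_K⁻¹)` — summable `D` in, `1∕log(1∕tail)` out: the two currencies agree MODULO THE INTRINSIC
LOGARITHM (p555512 ∕ module 63: not better). [bookkeeping] -/
theorem law_rate_of_summable_lawIncrements {vol l₀ : ℝ} (hvol : 0 < vol) (hl₀ : 0 < l₀) {D : ℕ → ℝ} (hDs : Summable D)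
    (hD : ∀ (os : List O) (K : ℕ) (g : ℝ → ℝ), Continuous g → ∀ Kg Gg : ℝ, 0 ≤ Kg →
      (∀ x y : ℝ, x ∈ Set.Icc (-1 : ℝ) 1 → y ∈ Set.Icc (-1 : ℝ) 1 → |g x - g y| ≤ Kg * |x - y|) →
      (∀ x : ℝ, x ∈ Set.Icc (-1 : ℝ) 1 → |g x| ≤ Gg) →
      |∫ U, g (prodObs S (K + 1) os U) ∂gibbsMeasure (S.P (K + 1)) (S.β (K + 1)) -
        ∫ U, g (prodObs S K os U) ∂gibbsMeasure (S.P K) (S.β K)| ≤ (Kg + Gg) * D K) (os : List O) :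
    (∀ os' : List O, NE7.Target vol l₀ (fun K => (l₀ + 1) * Real.exp (2 * l₀) * D K / vol) (schemeZ S os')) ∧
    ∃ ν : Measure ℝ, IsProbabilityMeasure ν ∧ ν (Set.Icc (-1 : ℝ) 1)ᶜ = 0 ∧
      (∀ f : ℝ → ℝ, Continuous f →
        Tendsto (fun K => ∫ U, f (prodObs S K os U) ∂gibbsMeasure (S.P K) (S.β K)) atTop (𝓝 (∫ x, f x ∂ν))) ∧
      ∀ {g : ℝ → ℝ}, Continuous g → ∀ {Kg Gg : ℝ}, 0 ≤ Kg →
        (∀ x y : ℝ, x ∈ Set.Icc (-1 : ℝ) 1 → y ∈ Set.Icc (-1 : ℝ) 1 → |g x - g y| ≤ Kg * |x - y|) →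
        (∀ x : ℝ, x ∈ Set.Icc (-1 : ℝ) 1 → |g x| ≤ Gg) → ∀ K : ℕ,
        0 < 4 * Real.exp (1 + l₀) / l₀ * (∑' j, 2 * ((l₀ + 1) * Real.exp (2 * l₀) * D (K + j))) *
            (1 + Real.posLog (∑' j, 2 * ((l₀ + 1) * Real.exp (2 * l₀) * D (K + j)))⁻¹) →
        4 * Real.exp (1 + l₀) / l₀ * (∑' j, 2 * ((l₀ + 1) * Real.exp (2 * l₀) * D (K + j))) *
            (1 + Real.posLog (∑' j, 2 * ((l₀ + 1) * Real.exp (2 * l₀) * D (K + j)))⁻¹) ≤ 1 →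
        |∫ U, g (prodObs S K os U) ∂gibbsMeasure (S.P K) (S.β K) - ∫ x, g x ∂ν| ≤
          48 * (Kg + Gg) / (1 + Real.log (4 * Real.exp (1 + l₀) / l₀ * (∑' j, 2 * ((l₀ + 1) * Real.exp (2 * l₀) * D (K + j))) *
            (1 + Real.posLog (∑' j, 2 * ((l₀ + 1) * Real.exp (2 * l₀) * D (K + j)))⁻¹))⁻¹) := by
  have hT : ∀ os' : List O, NE7.Target vol l₀ (fun K => (l₀ + 1) * Real.exp (2 * l₀) * D K / vol) (schemeZ S os') :=
    fun os' => target_of_summable_lawIncrements S hβ hm h1 hvol os' hDs (hD os')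
  obtain ⟨ν, iν, hν1, hν⟩ := exists_continuumLaw_of_target S hβ hm h1 hl₀ os (hT os)
  refine ⟨hT, ν, iν, hν1, hν, fun {g} hg {Kg Gg} hKg hK hG K hR0 hR1 => ?_⟩
  have hvolδ : ∀ j, vol * ((l₀ + 1) * Real.exp (2 * l₀) * D (K + j) / vol) = (l₀ + 1) * Real.exp (2 * l₀) * D (K + j) := fun j =>
    mul_div_cancel₀ _ hvol.ne'
  have h := abs_integral_sub_continuumLaw_le_inv_log_of_uniformTarget S hβ hm h1 hl₀ hT os ν hν1 hν hg hKg hK hG K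
  simp only [hvolδ] at h
  exact h hR0 hR1

end Scheme

end Summit.QuantumFields.YangMills.Theorems.BalabanUVNodesN19LawIncrementsTarget

end
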